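import Mathlib
import Literature.Probability.MarkovChains.MetropolisHastings
import Literature.Probability.MarkovChains.TotalVariation
import Summits.Ventures.LatticeQCDFlow.Exactness.FlowMCMC
import Summits.Ventures.LatticeQCDFlow.Scaling.ImportanceWeights
import Summits.Ventures.LatticeQCDFlow.Scaling.Bhattacharyya
import Summits.Ventures.LatticeQCDFlow.Scaling.IMHVolumeLaw
import Summits.Ventures.LatticeQCDFlow.Scaling.StochasticBudgets
import Summits.Ventures.LatticeQCDFlow.Scaling.VarianceLaws

/-!
# LatticeQCDFlow / Scaling — acceptance = pair-space total variation; acceptance blindness (T2-X)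

HONEST FRAMING: exact (Metropolis-corrected) sampling algorithms for lattice gauge theory;
figures of merit are autocorrelation/cost numbers at stated couplings and volumes; no
continuum-physics claim.

Venture `LatticeQCDFlow` (cell pub-lqcd), topic `Scaling`, THEORY-2.md §3.6 / §4 T2-X (v1.6),
prepared for landing by the theory seat (FANOUT row 29) from `HOME/THEORY-2-Sketch.lean` v1.8,
rebased on the tree's `Exactness/FlowMCMC` (`accRate`, `accRate_le`), `Scaling/Bhattacharyya`
(`sum_min_eq_one_sub_tvDist`), `Scaling/{ImportanceWeights, IMHVolumeLaw, StochasticBudgets}`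
(`prodLaw`, `blockProd`, `essFrac_blockProd`, `essFrac_le_one`) and `Scaling/VarianceLaws`
(`essFrac_pos`).

The mean Metropolis acceptance of the flow proposal at stationarity is an exact total-variation
distance — between the two ORDERINGS of the pair law, `p ⊗ q` and `q ⊗ p`
(`accRate_eq_one_sub_tvDist_prodLaw`) — so it is sandwiched
`1 − 2‖p − q‖_TV ≤ acc ≤ 1 − ‖p − q‖_TV` (`one_sub_two_tvDist_le_accRate`, tree `accRate_le`),
hence `acc ≥ 1 − √(1/ESS − 1)` (`one_sub_sqrt_le_accRate`: ESS floors acceptance), and for a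
target that is a MIXTURE `(1−θ) q + θ r` of the model with anything else the acceptance stays
`≥ 1 − θ` at every volume while the reweighting ESS is `(1 + θ²(1/ESS(r,q) − 1))⁻¹ ≤ θ⁻² ESS(r, q)`
(`essFrac_mixLaw`, `essFrac_mixLaw_le`), which for product `q`, `r` is `θ⁻² Π_blocks ESS_block → 0`
exponentially in the volume (`acceptance_blind`): ACCEPTANCE IS BLIND to reweighting quality —
the converse of "ESS floors acceptance" is false at every volume.  Printed counterpart
(qualitative): acceptance "is a measure of model quality but not a direct probe of
ergodicity/autocorrelation" (arXiv:1904.12072 §II.C); reverse-KL-trained models "can have high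
acceptance while missing modes" (arXiv:2107.00734 §II).

Elementary (`[folklore]`-level); farm `lean check` rc 0, no `sorry`.
-/

namespace Summit.Ventures.LatticeQCDFlow.Theory2

open Finset
open Literature.Probability.MarkovChains
open Summit.Ventures.LatticeQCDFlow.Exactness

variable {X : Type*} [Fintype X]

section AccTV

variable {Y : Type*} [Fintype Y]

omit [Fintype X] in
/-- Total variation is blind to an independent identical factor (right factor). [folklore] -/
theorem tvDist_prodLaw_right [Fintype X] (p p' : X → ℝ) {q : Y → ℝ} (hq : ∀ y, 0 ≤ q y)
    (hq1 : ∑ y, q y = 1) : tvDist (prodLaw p q) (prodLaw p' q) = tvDist p p' := by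
  unfold tvDist
  congr 1
  rw [Fintype.sum_prod_type]
  refine sum_congr rfl fun x _ => ?_
  have h : ∀ y, |prodLaw p q (x, y) - prodLaw p' q (x, y)| = |p x - p' x| * q y := fun y => by
    simp only [prodLaw]
    rw [← sub_mul, abs_mul, abs_of_nonneg (hq y)]
  simp_rw [h]
  rw [← mul_sum, hq1, mul_one]

/-- Total variation is blind to an independent identical factor (left factor). [folklore] -/
theorem tvDist_prodLaw_left {q : X → ℝ} (hq : ∀ x, 0 ≤ q x) (hq1 : ∑ x, q x = 1)
    (p p' : Y → ℝ) : tvDist (prodLaw q p) (prodLaw q p') = tvDist p p' := by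
  unfold tvDist
  congr 1
  rw [Fintype.sum_prod_type]
  have h : ∀ x y, |prodLaw q p (x, y) - prodLaw q p' (x, y)| = q x * |p y - p' y| :=
    fun x y => by
      simp only [prodLaw]
      rw [← mul_sub, abs_mul, abs_of_nonneg (hq x)]
  simp_rw [h, ← mul_sum]
  rw [← sum_mul, hq1, one_mul]

/-- **T2-X (acceptance identity; proved).**  `acc(p, q) = 1 − ‖p ⊗ q − q ⊗ p‖_TV`: the mean
Metropolis acceptance of an independence proposal at stationarity is ONE MINUS THE TOTAL VARIATION
between the pair law `(x, y) ∼ p ⊗ q` and its swap `q ⊗ p` (`Σ min(a, b) = 1 − TV(a, b)` on the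
pair space). [folklore] -/
theorem accRate_eq_one_sub_tvDist_prodLaw {p q : X → ℝ} (hp1 : ∑ x, p x = 1)
    (hq1 : ∑ x, q x = 1) : accRate p q = 1 - tvDist (prodLaw p q) (prodLaw q p) := by
  have h1 : ∑ z, prodLaw p q z = 1 := by rw [sum_prodLaw, hp1, hq1, mul_one]
  have h2 : ∑ z, prodLaw q p z = 1 := by rw [sum_prodLaw, hp1, hq1, one_mul]
  rw [← sum_min_eq_one_sub_tvDist h1 h2, accRate, Fintype.sum_prod_type]
  exact sum_congr rfl fun x _ => sum_congr rfl fun y _ => by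
    simp only [prodLaw]; rw [mul_comm (q x) (p y)]

/-- `‖p ⊗ q − q ⊗ p‖_TV ≤ 2‖p − q‖_TV` (triangle inequality through `q ⊗ q`). [folklore] -/
theorem tvDist_prodLaw_swap_le {p q : X → ℝ} (hq : ∀ x, 0 ≤ q x) (hq1 : ∑ x, q x = 1) :
    tvDist (prodLaw p q) (prodLaw q p) ≤ 2 * tvDist p q :=
  calc tvDist (prodLaw p q) (prodLaw q p)
      ≤ tvDist (prodLaw p q) (prodLaw q q) + tvDist (prodLaw q q) (prodLaw q p) :=
        tvDist_triangle _ _ _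
    _ = tvDist p q + tvDist q p := by
        rw [tvDist_prodLaw_right p q hq hq1, tvDist_prodLaw_left hq hq1 q p]
    _ = 2 * tvDist p q := by rw [tvDist_comm q p]; ring

/-- **T2-X (acceptance floor; proved).**  `1 − 2‖p − q‖_TV ≤ acc(p, q)` — with T2-E the mean
acceptance is pinned to the window `[1 − 2 TV, 1 − TV]`: it measures the GLOBAL total variation and
nothing else (no volume law of its own beyond that of `TV`, cf. `AccBlockDefectVolumeLaw`, which
needs product structure on BOTH sides). [folklore] -/
theorem one_sub_two_tvDist_le_accRate {p q : X → ℝ} (hp1 : ∑ x, p x = 1) (hq : ∀ x, 0 ≤ q x)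
    (hq1 : ∑ x, q x = 1) : 1 - 2 * tvDist p q ≤ accRate p q := by
  rw [accRate_eq_one_sub_tvDist_prodLaw hp1 hq1]
  linarith [tvDist_prodLaw_swap_le (p := p) hq hq1]

/-- Acceptance `≥ c` whenever `p ≥ c · q` pointwise (the model is a `c`-fraction of the target).
[folklore] -/
theorem le_accRate_of_mul_le {p q : X → ℝ} {c : ℝ} (hq : ∀ x, 0 ≤ q x) (hq1 : ∑ x, q x = 1)
    (hc : ∀ x, c * q x ≤ p x) : c ≤ accRate p q := by
  unfold accRate
  have h1 : ∑ x, ∑ y, c * (q x * q y) = c := by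
    have : ∀ x, ∑ y, c * (q x * q y) = c * q x := fun x => by
      rw [← mul_sum, ← mul_sum, hq1, mul_one]
    simp_rw [this]
    rw [← mul_sum, hq1, mul_one]
  calc c = ∑ x, ∑ y, c * (q x * q y) := h1.symm
    _ ≤ ∑ x, ∑ y, min (p x * q y) (p y * q x) :=
        sum_le_sum fun x _ => sum_le_sum fun y _ => le_min
          (by rw [← mul_assoc]; exact mul_le_mul_of_nonneg_right (hc x) (hq y))
          (by rw [mul_comm (q x) (q y), ← mul_assoc]
              exact mul_le_mul_of_nonneg_right (hc y) (hq x))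

/-- **(2·TV)² ≤ χ²(p‖q) = 1/ESS − 1** (Cauchy–Schwarz with weights `q`; `Σ (p−q)²/q = Σ p²/q − 1`).
[folklore] -/
theorem sq_two_mul_tvDist_le {p q : X → ℝ} (hq : ∀ x, 0 < q x) (hp1 : ∑ x, p x = 1)
    (hq1 : ∑ x, q x = 1) : (2 * tvDist p q) ^ 2 ≤ (essFrac p q)⁻¹ - 1 := by
  rw [essFrac_eq_inv hq hp1, inv_inv]
  have h1 : ∑ x, p x * weight p q x - 1 = ∑ x, (p x - q x) ^ 2 / q x := by
    have : ∑ x, (p x - q x) ^ 2 / q x = ∑ x, (p x * weight p q x - 2 * p x + q x) := by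
      refine sum_congr rfl fun x _ => ?_
      rw [mul_weight_eq_sq_div]
      field_simp [(hq x).ne']
      ring
    rw [this, sum_add_distrib, sum_sub_distrib, ← mul_sum, hp1, hq1]; ring
  have h2 : 2 * tvDist p q = ∑ x, |p x - q x| := by unfold tvDist; ring
  rw [h2, h1]
  have hrepr : ∑ x, |p x - q x| = ∑ x, |p x - q x| / Real.sqrt (q x) * Real.sqrt (q x) :=
    sum_congr rfl fun x _ => (div_mul_cancel₀ _ (Real.sqrt_pos.2 (hq x)).ne').symm
  rw [hrepr]
  calc (∑ x, |p x - q x| / Real.sqrt (q x) * Real.sqrt (q x)) ^ 2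
      ≤ (∑ x, (|p x - q x| / Real.sqrt (q x)) ^ 2) * ∑ x, Real.sqrt (q x) ^ 2 :=
        Finset.sum_mul_sq_le_sq_mul_sq _ _ _
    _ = ∑ x, (p x - q x) ^ 2 / q x := by
        have hs : ∀ x, Real.sqrt (q x) ^ 2 = q x := fun x => Real.sq_sqrt (hq x).le
        simp_rw [div_pow, sq_abs, hs, hq1, mul_one]

/-- **ESS floors acceptance, never conversely:** `acc ≥ 1 − 2·TV ≥ 1 − √(1/ESS − 1)` — a lane with
(population) `ESS/N = 0.8` has acceptance `≥ 0.5`, with `0.99` acceptance `≥ 0.899`; vacuous below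
`ESS = ½`.  The converse implication is FALSE at every volume (`acceptance_blind` below).
[folklore] -/
theorem one_sub_sqrt_le_accRate {p q : X → ℝ} (hq : ∀ x, 0 < q x) (hp1 : ∑ x, p x = 1)
    (hq1 : ∑ x, q x = 1) : 1 - Real.sqrt ((essFrac p q)⁻¹ - 1) ≤ accRate p q := by
  have h := one_sub_two_tvDist_le_accRate hp1 (fun x => (hq x).le) hq1
  have h2 : 2 * tvDist p q ≤ Real.sqrt ((essFrac p q)⁻¹ - 1) := by
    rw [← Real.sqrt_sq (mul_nonneg zero_le_two (tvDist_nonneg p q))]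
    exact Real.sqrt_le_sqrt (sq_two_mul_tvDist_le hq hp1 hq1)
  linarith

/-- Two-component mixture law `(1 − θ) q + θ r`. -/
noncomputable def mixLaw (θ : ℝ) (q r : X → ℝ) : X → ℝ := fun x => (1 - θ) * q x + θ * r x

/-- The mixture of two probability vectors is a probability vector. [folklore] -/
theorem sum_mixLaw (θ : ℝ) {q r : X → ℝ} (hq1 : ∑ x, q x = 1) (hr1 : ∑ x, r x = 1) :
    ∑ x, mixLaw θ q r x = 1 := by
  unfold mixLaw
  rw [sum_add_distrib, ← mul_sum, ← mul_sum, hq1, hr1]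
  ring

omit [Fintype X] in
/-- `(1 − θ)·q ≤ (1 − θ)·q + θ·r` pointwise for `θ, r ≥ 0`. [folklore] -/
theorem mul_le_mixLaw (θ : ℝ) {q r : X → ℝ} (hθ : 0 ≤ θ) (hr : ∀ x, 0 ≤ r x) (x : X) :
    (1 - θ) * q x ≤ mixLaw θ q r x := by
  unfold mixLaw
  nlinarith [hr x]

/-- **T2-X (mixture ESS identity; proved).**  For the target `p = (1 − θ) q + θ r`:
`ESS(p, q) = (1 + θ² (1/ESS(r, q) − 1))⁻¹` exactly. [folklore] -/
theorem essFrac_mixLaw {q r : X → ℝ} (hq : ∀ x, 0 < q x) (hq1 : ∑ x, q x = 1)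
    (hr1 : ∑ x, r x = 1) (θ : ℝ) :
    essFrac (mixLaw θ q r) q = (1 + θ ^ 2 * ((essFrac r q)⁻¹ - 1))⁻¹ := by
  have hqne : ∀ x, q x ≠ 0 := fun x => (hq x).ne'
  rw [essFrac_eq_sq_div hqne, essFrac_eq_sq_div hqne, sum_mixLaw θ hq1 hr1, hr1]
  simp only [one_pow, one_div, inv_inv]
  congr 1
  have h : ∀ x, mixLaw θ q r x ^ 2 / q x =
      (1 - θ) ^ 2 * q x + 2 * ((1 - θ) * θ) * r x + θ ^ 2 * (r x ^ 2 / q x) := fun x => by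
    have hx := hqne x
    unfold mixLaw
    field_simp
    ring
  simp_rw [h]
  rw [sum_add_distrib, sum_add_distrib, ← mul_sum, ← mul_sum, ← mul_sum, hq1, hr1]
  ring

/-- **T2-X (mixture ESS bound; proved).**  `ESS((1−θ) q + θ r, q) ≤ θ⁻² · ESS(r, q)`. -/
theorem essFrac_mixLaw_le {q r : X → ℝ} (hq : ∀ x, 0 < q x) (hq1 : ∑ x, q x = 1)
    (hr1 : ∑ x, r x = 1) {θ : ℝ} (hθ : 0 < θ) (hθ1 : θ ≤ 1) :
    essFrac (mixLaw θ q r) q ≤ θ⁻¹ ^ 2 * essFrac r q := by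
  rw [essFrac_mixLaw hq hq1 hr1 θ]
  set E := essFrac r q with hE
  have hE0 : 0 < E := essFrac_pos hq hr1
  have hE1 : E ≤ 1 := essFrac_le_one hq hr1 hq1
  have hθ2 : 0 < θ ^ 2 := pow_pos hθ 2
  have hθ21 : θ ^ 2 ≤ 1 := pow_le_one₀ hθ.le hθ1
  have hEi : 0 < E⁻¹ := inv_pos.2 hE0
  have hkey : θ ^ 2 * E⁻¹ ≤ 1 + θ ^ 2 * (E⁻¹ - 1) := by nlinarith
  have hpos : 0 < θ ^ 2 * E⁻¹ := mul_pos hθ2 hEi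
  calc (1 + θ ^ 2 * (E⁻¹ - 1))⁻¹ ≤ (θ ^ 2 * E⁻¹)⁻¹ := inv_anti₀ hpos hkey
    _ = θ⁻¹ ^ 2 * E := by rw [mul_inv, inv_inv, inv_pow]

/-- **T2-X (acceptance blindness of a volume family; proved).**  Product model `⊗ qb` on `m`
blocks, target the mixture `(1 − θ)·(⊗ qb) + θ·(⊗ rb)`: the stationary acceptance is `≥ 1 − θ`
for EVERY `m`, while `ESS ≤ θ⁻² Π_i ESS(rb_i, qb_i)` — exponentially small in the number of
blocks as soon as one block law differs.  Acceptance cannot certify a volume family. [folklore] -/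
theorem acceptance_blind {m : ℕ} {Z : Type*} [Fintype Z] {qb rb : Fin m → Z → ℝ}
    (hq : ∀ i z, 0 < qb i z) (hq1 : ∀ i, ∑ z, qb i z = 1) (hr : ∀ i z, 0 ≤ rb i z)
    (hr1 : ∀ i, ∑ z, rb i z = 1) {θ : ℝ} (hθ : 0 < θ) (hθ1 : θ ≤ 1) :
    1 - θ ≤ accRate (mixLaw θ (blockProd qb) (blockProd rb)) (blockProd qb) ∧
      essFrac (mixLaw θ (blockProd qb) (blockProd rb)) (blockProd qb) ≤
        θ⁻¹ ^ 2 * ∏ i, essFrac (rb i) (qb i) := by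
  have hQ : ∀ φ, 0 < blockProd qb φ := blockProd_pos hq
  have hQ1 : ∑ φ, blockProd qb φ = 1 := by rw [sum_blockProd]; simp [hq1]
  have hR : ∀ φ, 0 ≤ blockProd rb φ := fun φ => prod_nonneg fun i _ => hr i (φ i)
  have hR1 : ∑ φ, blockProd rb φ = 1 := by rw [sum_blockProd]; simp [hr1]
  refine ⟨le_accRate_of_mul_le (fun φ => (hQ φ).le) hQ1 (mul_le_mixLaw θ hθ.le hR), ?_⟩
  rw [← essFrac_blockProd_of_pos hq]
  exact essFrac_mixLaw_le hQ hQ1 hR1 hθ hθ1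

end AccTV

end Summit.Ventures.LatticeQCDFlow.Theory2
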